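import Summits.NavierStokesRegularity.NavierStokesRegularity.Theorems.PerpetualPumpCircuitPumpGateFlip

/-!
# Active block of the Toda pump over one period: tools
# (crux `PerpetualPump.CircuitPump`, stmt-NavierStokesRegularity-1834; line `singular-clock-gspt`,
# helpers for the sub-goal `toda_active_core` of `stub_clockBox`)

Folklore real analysis around the damped Toda transfer gate `u' = −u − v² + p`,
`v' = v(u − w) − v + s`, `w' = −νw + v² + r` (`|p|, |r| ≤ P`, `0 ≤ s ≤ P`):

* `toda_gate_flip_of_entry_apriori`, `toda_gate_flip_of_entry`: the gate flip of
  `Theorems/PerpetualPumpCircuitPumpGateFlip.lean` with the ENTRY CONDITION `v(tg) ≥ A/8`,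
  `D(tg) ≥ 0` (instead of `v ≥ R/8`): in the variables `G = R + D`, `H = R − D` one still has
  `G(tg) ≥ R ≥ A/3` and `H(tg) = 2v²/G ≥ 2(A/8)²/(3A) = A/96 ≥ A/192`, which is all the abstract
  continuity argument `toda_gate_flip_dynamics` needs;
* `gate_flipped_geometry`: after the flip (`D ≤ 0`), `0 ≤ R + D ≤ 2v²/R`, so the old carrier
  `u = (σ + (R + D))/2` and the new one `w = R + σ/2 − (R + D)/2` are pinned by `|σ|/2 + v²/R`;
* `gate_sqrt_shift_le`: the gate radius `√((a − b)² + c)` is `1`-Lipschitz in `b`;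
* `seed_barrier`, `seed_lower`: one-sided barriers for the seeded new bond
  `z' = z·c + q` (`q ≥ 0`): an upper bound through any explicit super-solution exponent `Φ`
  (`Φ' ≥ c`), and the trivial lower bound from `z' ≥ q` while the rate is non-negative.
-/

noncomputable section

-- the summit namespace `…NavierStokesRegularity.NavierStokesRegularity…` is the tree convention
set_option linter.dupNamespace false

namespace Summit.NavierStokesRegularity.NavierStokesRegularity.Theorems.PerpetualPumpCircuitPump

open Set Filter Topology Literature.Analysis.ODE

/-- **The flip from the entry condition `v(tg) ≥ A/8`, `D(tg) ≥ 0`, given the a-priori gate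
bounds** (`v ≥ 0`, `A/3 ≤ R ≤ 3A/2`, `(ν−1)w + p − r ≤ 1.01A` on `[0,T]`): builds `G = R + D`,
`H = R − D` along the gate ODE, checks the differential inequalities of `flip_GH_deriv_bounds`
and the initial sizes `G(tg) ≥ A/3`, `H(tg) = 2v²/(R + D) ≥ 2(A/8)²/(3A) ≥ A/192`, and reads the
conclusion of `toda_gate_flip_dynamics` as `D ≤ −(9/10)R` plus the bond decay. [folklore] -/
theorem toda_gate_flip_of_entry_apriori {ν P T A tg : ℝ} {u v w p r s : ℝ → ℝ}
    (hP : 0 ≤ P) (hA : 10000 * (1 + P) ≤ A)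
    (hu : ContinuousOn u (Icc 0 T)) (hv : ContinuousOn v (Icc 0 T))
    (hw : ContinuousOn w (Icc 0 T))
    (hu' : ∀ t ∈ Ico 0 T, HasDerivWithinAt u (-u t - v t ^ 2 + p t) (Ici t) t)
    (hv' : ∀ t ∈ Ico 0 T, HasDerivWithinAt v (v t * (u t - w t) - v t + s t) (Ici t) t)
    (hw' : ∀ t ∈ Ico 0 T, HasDerivWithinAt w (-ν * w t + v t ^ 2 + r t) (Ici t) t)
    (hs : ∀ t ∈ Icc 0 T, 0 ≤ s t ∧ s t ≤ P)
    (htg : tg ∈ Icc 0 T) (htgT : tg + 250 / A ≤ T)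
    (hgate : A / 8 ≤ v tg) (hD0 : 0 ≤ u tg - w tg)
    (hap : ∀ t ∈ Icc 0 T, 0 ≤ v t ∧ A / 3 ≤ Real.sqrt ((u t - w t) ^ 2 + 2 * v t ^ 2) ∧
      Real.sqrt ((u t - w t) ^ 2 + 2 * v t ^ 2) ≤ 3 * A / 2 ∧
      (ν - 1) * w t + p t - r t ≤ 101 * A / 100) :
    ∀ t ∈ Icc (tg + 250 / A) T,
      u t - w t ≤ -(9 / 10) * Real.sqrt ((u t - w t) ^ 2 + 2 * v t ^ 2) ∧
      v t ≤ A * Real.exp (-(A / 4) * (t - (tg + 250 / A))) + 8 * P / A := by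
  have hA' : 10000 ≤ A := by nlinarith
  have hPA : 10000 * P ≤ A := by nlinarith
  have hApos : 0 < A := by linarith
  have hsubT : Icc tg T ⊆ Icc 0 T := Icc_subset_Icc_left htg.1
  set R : ℝ → ℝ := fun t => Real.sqrt ((u t - w t) ^ 2 + 2 * v t ^ 2) with hR
  set Dd : ℝ → ℝ := fun t => (-u t - v t ^ 2 + p t) - (-ν * w t + v t ^ 2 + r t) with hDd
  set Rd : ℝ → ℝ := fun t =>
    ((u t - w t) * Dd t + 2 * v t * (v t * (u t - w t) - v t + s t)) / R t with hRd
  -- pointwise facts on `[0, T]`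
  have hRsq : ∀ t, R t ^ 2 = (u t - w t) ^ 2 + 2 * v t ^ 2 := fun t =>
    Real.sq_sqrt (by positivity)
  have hDabs : ∀ t, |u t - w t| ≤ R t := fun t =>
    Real.abs_le_sqrt (by nlinarith [sq_nonneg (v t)])
  have hvR : ∀ t, v t ≤ R t := fun t =>
    Real.le_sqrt_of_sq_le (by nlinarith [sq_nonneg (u t - w t), sq_nonneg (v t)])
  have hRc : ContinuousOn R (Icc 0 T) :=
    (((hu.sub hw).pow 2).add ((hv.pow 2).const_mul 2)).sqrt
  -- the abstract flip
  have key := toda_gate_flip_dynamics A P tg T (fun t => R t + (u t - w t))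
    (fun t => R t - (u t - w t)) v (fun t => Rd t + Dd t) (fun t => Rd t - Dd t)
    (fun t => v t * (u t - w t) - v t + s t) hA' hP hPA
    ((hRc.add (hu.sub hw)).mono hsubT) ((hRc.sub (hu.sub hw)).mono hsubT) (hv.mono hsubT)
    ?_ ?_ (fun t ht => hv' t ⟨htg.1.trans ht.1, ht.2⟩) ?_ ?_ ?_
    (fun t ht => (hap t (hsubT ht)).1) ?_ ?_ ?_ ?_ ?_ ?_ htgT
  · -- read off the conclusion
    intro t ht
    obtain ⟨h1, h2⟩ := key t ht
    refine ⟨?_, h2⟩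
    linarith
  · -- hGd
    intro t ht
    have ht' : t ∈ Ico 0 T := ⟨htg.1.trans ht.1, ht.2⟩
    have hpos : 0 < (u t - w t) ^ 2 + 2 * v t ^ 2 :=
      Real.sqrt_pos.mp (by linarith [(hap t (Ico_subset_Icc_self ht')).2.1])
    exact (flip_GH_hasDerivWithinAt (hu' t ht') (hv' t ht') (hw' t ht') hpos).1
  · -- hHd
    intro t ht
    have ht' : t ∈ Ico 0 T := ⟨htg.1.trans ht.1, ht.2⟩
    have hpos : 0 < (u t - w t) ^ 2 + 2 * v t ^ 2 :=
      Real.sqrt_pos.mp (by linarith [(hap t (Ico_subset_Icc_self ht')).2.1])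
    exact (flip_GH_hasDerivWithinAt (hu' t ht') (hv' t ht') (hw' t ht') hpos).2
  · -- hG0
    intro t _
    have := (abs_le.mp (hDabs t)).1
    linarith
  · -- hH0
    intro t _
    have := (abs_le.mp (hDabs t)).2
    linarith
  · -- hsum
    intro t ht
    have := (hap t (hsubT ht)).2
    constructor <;> linarith
  · -- hvR
    intro t _
    have := hvR t
    linarith
  · -- hG'
    intro t ht
    have ht' : t ∈ Icc 0 T := hsubT (Ico_subset_Icc_self ht)
    obtain ⟨hv0, hRlo, -, hY⟩ := hap t ht'
    have hR3 : (0 : ℝ) < A / 3 := by positivity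
    have hRne : R t ≠ 0 := by linarith
    have hRdR : Rd t * R t = (u t - w t) * Dd t + 2 * v t * (v t * (u t - w t) - v t + s t) :=
      div_mul_cancel₀ _ hRne
    have hY' : (ν - 1) * w t + p t - r t ≤ 303 / 100 * (A / 3) := by linarith
    exact (flip_GH_deriv_bounds hR3 hRlo (hRsq t) hv0 (hs t ht').1 (hs t ht').2 hY'
      (by norm_num) hRdR).1
  · -- hH'
    intro t ht
    have ht' : t ∈ Icc 0 T := hsubT (Ico_subset_Icc_self ht)
    obtain ⟨hv0, hRlo, -, hY⟩ := hap t ht'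
    have hR3 : (0 : ℝ) < A / 3 := by positivity
    have hRne : R t ≠ 0 := by linarith
    have hRdR : Rd t * R t = (u t - w t) * Dd t + 2 * v t * (v t * (u t - w t) - v t + s t) :=
      div_mul_cancel₀ _ hRne
    have hY' : (ν - 1) * w t + p t - r t ≤ 303 / 100 * (A / 3) := by linarith
    exact (flip_GH_deriv_bounds hR3 hRlo (hRsq t) hv0 (hs t ht').1 (hs t ht').2 hY'
      (by norm_num) hRdR).2
  · -- hv'
    intro t ht
    have ht' : t ∈ Icc 0 T := hsubT (Ico_subset_Icc_self ht)
    have hsP := (hs t ht').2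
    calc v t * (u t - w t) - v t + s t ≤ v t * (u t - w t) - v t + P := by linarith
      _ = v t * ((R t + (u t - w t) - (R t - (u t - w t))) / 2 - 1) + P := by ring
  · -- hGtg
    have := (hap tg htg).2.1
    linarith
  · -- hHtg : A/192 ≤ R tg - D tg, from H · G = 2 v², G ≤ 2 R ≤ 3 A, v ≥ A / 8
    obtain ⟨-, hRlo, hRhi, -⟩ := hap tg htg
    have hRpos : 0 < R tg := by linarith
    have hv2 : (A / 8) ^ 2 ≤ v tg ^ 2 := pow_le_pow_left₀ (by positivity) hgate 2
    have hprod : (R tg - (u tg - w tg)) * (R tg + (u tg - w tg)) = 2 * v tg ^ 2 := by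
      have := hRsq tg; nlinarith [this]
    have hH0 : 0 ≤ R tg - (u tg - w tg) := by linarith [(abs_le.mp (hDabs tg)).2]
    have hG3 : R tg + (u tg - w tg) ≤ 3 * A := by linarith [(abs_le.mp (hDabs tg)).2]
    have h1 : (R tg - (u tg - w tg)) * (R tg + (u tg - w tg)) ≤
        (R tg - (u tg - w tg)) * (3 * A) := mul_le_mul_of_nonneg_left hG3 hH0
    have h2 : A / 96 * (3 * A) ≤ (R tg - (u tg - w tg)) * (3 * A) := by nlinarith
    have h3 : A / 96 ≤ R tg - (u tg - w tg) := le_of_mul_le_mul_right h2 (by positivity)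
    linarith

/-- **GATE FLIP FROM THE ENTRY CONDITION `v(tg) ≥ A/8`.** In the setting of `toda_gate_sigma`
(with `A ≥ 10⁴(1+P)`): if at some time `tg` the bond has reached `A/8` with the old carrier still
ahead (`D = u − w ≥ 0`), then within time `250/A` the gate has FLIPPED — `D ≤ −(9/10) R` — and
stays flipped, while the bond decays exponentially at rate `≥ A/4` down to the seed floor `8P/A`.
(Same mechanism as `toda_gate_flip`; only the entry size `H(tg) = 2v²/(R + D) ≥ A/96` differs.)
[folklore] -/
theorem toda_gate_flip_of_entry :
    ∀ (ν P T A tg : ℝ) (u v w p r s : ℝ → ℝ),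
    1 ≤ ν → ν ≤ 2 → 0 ≤ P → 0 < T → T ≤ 1 / 2 → 10000 * (1 + P) ≤ A →
    u 0 = A → 0 ≤ w 0 → w 0 ≤ 1 → 0 < v 0 → v 0 ≤ 1 →
    ContinuousOn u (Set.Icc 0 T) → ContinuousOn v (Set.Icc 0 T) → ContinuousOn w (Set.Icc 0 T) →
    (∀ t ∈ Set.Ico 0 T, HasDerivWithinAt u (-u t - v t ^ 2 + p t) (Set.Ici t) t) →
    (∀ t ∈ Set.Ico 0 T, HasDerivWithinAt v (v t * (u t - w t) - v t + s t) (Set.Ici t) t) →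
    (∀ t ∈ Set.Ico 0 T, HasDerivWithinAt w (-ν * w t + v t ^ 2 + r t) (Set.Ici t) t) →
    (∀ t ∈ Set.Icc 0 T, |p t| ≤ P) → (∀ t ∈ Set.Icc 0 T, |r t| ≤ P) →
    (∀ t ∈ Set.Icc 0 T, 0 ≤ s t ∧ s t ≤ P) →
    tg ∈ Set.Icc 0 T → tg + 250 / A ≤ T → A / 8 ≤ v tg → 0 ≤ u tg - w tg →
    ∀ t ∈ Set.Icc (tg + 250 / A) T,
      u t - w t ≤ -(9 / 10) * Real.sqrt ((u t - w t) ^ 2 + 2 * v t ^ 2) ∧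
      v t ≤ A * Real.exp (-(A / 4) * (t - (tg + 250 / A))) + 8 * P / A := by
  intro ν P T A tg u v w p r s hν1 hν2 hP hT0 hT hA hu0 hw0 hw1 hv0 hv1 hu hv hw hu' hv' hw' hp hr
    hs htg htgT hgate hD0
  have hsig := toda_gate_sigma ν P T A u v w p r s hν1 hν2 hP hT0 hT (by linarith) hu0 hw0 hw1
    hv0 hv1 hu hv hw hu' hv' hw' hp hr hs
  refine toda_gate_flip_of_entry_apriori hP hA hu hv hw hu' hv' hw' hs htg htgT hgate hD0 ?_
  intro t ht
  obtain ⟨hv0t, -, -, hSup, hR3, hσ⟩ := hsig t ht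
  obtain ⟨hRup, hY⟩ := toda_gate_apriori_of_sigma hν1 hν2 hP hA (ht.2.trans hT) (hp t ht) (hr t ht)
    hSup hσ
  exact ⟨hv0t, hR3, hRup, hY⟩

/-- **Post-flip geometry of the gate.** With `R = √((U − W)² + 2V²) > 0`, `D = U − W ≤ 0` and
`|U + W − R| ≤ σB`: `0 ≤ R + D = 2V²/(R − D) ≤ 2V²/R`, hence `|U| ≤ σB/2 + V²/R` and
`|W − R| ≤ σB/2 + V²/R` (`U = (σ + (R + D))/2`, `W − R = (σ − (R + D))/2`). [folklore] -/
theorem gate_flipped_geometry {U V W R σB : ℝ}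
    (hR : Real.sqrt ((U - W) ^ 2 + 2 * V ^ 2) = R) (hR0 : 0 < R) (hD : U - W ≤ 0)
    (hσ : |U + W - R| ≤ σB) :
    |U| ≤ σB / 2 + V ^ 2 / R ∧ |W - R| ≤ σB / 2 + V ^ 2 / R := by
  have hR2 : R ^ 2 = (U - W) ^ 2 + 2 * V ^ 2 := by
    rw [← hR]; exact Real.sq_sqrt (by positivity)
  have hD2 : (U - W) ^ 2 ≤ R ^ 2 := by rw [hR2]; nlinarith [sq_nonneg V]
  obtain ⟨hDlo, -⟩ := abs_le_of_sq_le_sq' hD2 hR0.le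
  have hG0 : 0 ≤ R + (U - W) := by linarith
  have hGup : R + (U - W) ≤ 2 * (V ^ 2 / R) := by
    rw [show 2 * (V ^ 2 / R) = 2 * V ^ 2 / R by ring, le_div_iff₀ hR0]
    have h1 : (R + (U - W)) * (R - (U - W)) = 2 * V ^ 2 := by nlinarith [hR2]
    nlinarith [mul_nonneg hG0 (by linarith : (0 : ℝ) ≤ -(U - W))]
  obtain ⟨hσ1, hσ2⟩ := abs_le.mp hσ
  have hV2R : 0 ≤ V ^ 2 / R := by positivity
  constructor
  · rw [abs_le]; constructor <;> linarith
  · rw [abs_le]; constructor <;> linarith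

/-- The gate radius `√((a − b)² + c)` (`c ≥ 0`) is `1`-Lipschitz in the carrier coordinate `b`.
[folklore] -/
theorem gate_sqrt_shift_le (a b b' c : ℝ) (hc : 0 ≤ c) :
    Real.sqrt ((a - b) ^ 2 + c) ≤ Real.sqrt ((a - b') ^ 2 + c) + |b - b'| := by
  have hR := Real.sqrt_nonneg ((a - b') ^ 2 + c)
  have hR2 : Real.sqrt ((a - b') ^ 2 + c) ^ 2 = (a - b') ^ 2 + c :=
    Real.sq_sqrt (by positivity)
  have hDR : |a - b'| ≤ Real.sqrt ((a - b') ^ 2 + c) := Real.abs_le_sqrt (by linarith)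
  rw [Real.sqrt_le_iff]
  refine ⟨by positivity, ?_⟩
  have h1 : (a - b) ^ 2 ≤ (a - b') ^ 2 + 2 * (|a - b'| * |b - b'|) + (b - b') ^ 2 := by
    have e : a - b = (a - b') - (b - b') := by ring
    rw [e, sub_sq, ← abs_mul]
    nlinarith [neg_abs_le ((a - b') * (b - b'))]
  nlinarith [mul_le_mul_of_nonneg_right hDR (abs_nonneg (b - b')), sq_abs (b - b')]

/-- **Seed barrier (upper).** If `z' = z·c + q` on `[a, b)` with `z ≥ 0`, `0 ≤ q ≤ Q`, and `Φ` is
an explicit exponent with `Φ' ≥ c` and `Φ ≥ Φ(a)` on `[a, b]`, then `z e^{Φ(a) − Φ}` grows at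
rate at most `Q`, i.e. `z(b) ≤ e^{Φ(b) − Φ(a)} (z(a) + Q (b − a))`. [folklore] -/
theorem seed_barrier {a b Q : ℝ} {z Φ c q Φ' : ℝ → ℝ} (hab : a ≤ b)
    (hz : ContinuousOn z (Icc a b)) (hΦ : ContinuousOn Φ (Icc a b))
    (hz' : ∀ t ∈ Ico a b, HasDerivWithinAt z (z t * c t + q t) (Ici t) t)
    (hΦ' : ∀ t ∈ Ico a b, HasDerivWithinAt Φ (Φ' t) (Ici t) t)
    (hc : ∀ t ∈ Ico a b, c t ≤ Φ' t) (hz0 : ∀ t ∈ Icc a b, 0 ≤ z t)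
    (hq : ∀ t ∈ Ico a b, 0 ≤ q t ∧ q t ≤ Q) (hΦa : ∀ t ∈ Icc a b, Φ a ≤ Φ t) :
    z b ≤ Real.exp (Φ b - Φ a) * (z a + Q * (b - a)) := by
  have hg' : ∀ t ∈ Ico a b, HasDerivWithinAt (fun y => z y * Real.exp (Φ a - Φ y))
      ((z t * c t + q t) * Real.exp (Φ a - Φ t) + z t * (Real.exp (Φ a - Φ t) * -Φ' t))
      (Ici t) t :=
    fun t ht => (hz' t ht).mul ((hΦ' t ht).const_sub (Φ a)).exp
  have hgc : ContinuousOn (fun y => z y * Real.exp (Φ a - Φ y)) (Icc a b) :=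
    hz.mul (continuousOn_const.sub hΦ).rexp
  have h := sub_le_mul_of_deriv_right_le (M := Q) hgc hg' (fun t ht => by
    have he1 : Real.exp (Φ a - Φ t) ≤ 1 :=
      Real.exp_le_one_iff.mpr (by linarith [hΦa t (Ico_subset_Icc_self ht)])
    have he0 := Real.exp_pos (Φ a - Φ t)
    obtain ⟨hq0, hqQ⟩ := hq t ht
    have h1 : z t * (c t - Φ' t) ≤ 0 :=
      mul_nonpos_of_nonneg_of_nonpos (hz0 t (Ico_subset_Icc_self ht)) (by linarith [hc t ht])
    have h2 : Real.exp (Φ a - Φ t) * (z t * (c t - Φ' t)) ≤ 0 :=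
      mul_nonpos_of_nonneg_of_nonpos he0.le h1
    have h3 : Real.exp (Φ a - Φ t) * q t ≤ q t := mul_le_of_le_one_left hq0 he1
    have e : (z t * c t + q t) * Real.exp (Φ a - Φ t) + z t * (Real.exp (Φ a - Φ t) * -Φ' t) =
        Real.exp (Φ a - Φ t) * (z t * (c t - Φ' t)) + Real.exp (Φ a - Φ t) * q t := by ring
    rw [e]
    linarith) b ⟨hab, le_rfl⟩
  simp only [sub_self, Real.exp_zero, mul_one] at h
  have hE : Real.exp (Φ b - Φ a) * Real.exp (Φ a - Φ b) = 1 := by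
    rw [← Real.exp_add]; simp
  calc z b = Real.exp (Φ b - Φ a) * (z b * Real.exp (Φ a - Φ b)) := by
        rw [mul_comm (z b), ← mul_assoc, hE, one_mul]
    _ ≤ Real.exp (Φ b - Φ a) * (z a + Q * (b - a)) :=
        mul_le_mul_of_nonneg_left (by linarith) (Real.exp_pos _).le

/-- **Seed barrier (lower).** For the seeded new bond `z' = z (lam (w − y) − ν) + ε lam w²` with
`z ≥ 0`, `|y| ≤ 1`, `lam ≥ 1`: while the new carrier satisfies `w ≥ m ≥ 0` with
`lam (m − 1) ≥ ν` (non-negative rate), `z` gains at least `ε m²` per unit time. [folklore] -/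
theorem seed_lower {a b lam ν ε m : ℝ} {z w y : ℝ → ℝ} (hab : a ≤ b)
    (hz : ContinuousOn z (Icc a b))
    (hz' : ∀ t ∈ Ico a b, HasDerivWithinAt z
      (z t * (lam * (w t - y t) - ν) + ε * lam * w t ^ 2) (Ici t) t)
    (hz0 : ∀ t ∈ Icc a b, 0 ≤ z t) (hw : ∀ t ∈ Icc a b, m ≤ w t)
    (hy : ∀ t ∈ Icc a b, |y t| ≤ 1) (hlam : 1 ≤ lam) (hε : 0 ≤ ε) (hm : 0 ≤ m)
    (hν : ν ≤ lam * (m - 1)) :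
    z a + ε * m ^ 2 * (b - a) ≤ z b := by
  have h := mul_le_sub_of_le_deriv_right (M := ε * m ^ 2) hz hz' (fun t ht => by
    have ht' := Ico_subset_Icc_self ht
    have hwt := hw t ht'
    have hyt := (abs_le.mp (hy t ht')).2
    have h0 : lam * (m - 1) ≤ lam * (w t - y t) :=
      mul_le_mul_of_nonneg_left (by linarith) (by linarith)
    have h1 : 0 ≤ z t * (lam * (w t - y t) - ν) := mul_nonneg (hz0 t ht') (by linarith)
    have h2 : m ^ 2 ≤ w t ^ 2 := pow_le_pow_left₀ hm hwt 2
    have h3 : 0 ≤ ε * w t ^ 2 * (lam - 1) :=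
      mul_nonneg (mul_nonneg hε (sq_nonneg _)) (by linarith)
    nlinarith [mul_le_mul_of_nonneg_left h2 hε]) b ⟨hab, le_rfl⟩
  linarith

end Summit.NavierStokesRegularity.NavierStokesRegularity.Theorems.PerpetualPumpCircuitPump
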